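import Literature.AnabelianGeometry.AbsoluteAnabelian.FundamentalExtension
import HarnessLib

/-!
# Restriction adapters for the extension `1 → Δ → Π → G → 1`: open subgroups and base change

abc-iut cell, L4 adapters A1/A8 for the L5 §6 instance programme (L4-lead RULING #3l, L5-lead
RULINGS #17/#20; writer abc-iut-w5-d053, consumer abc-iut-L5-t4).  Pure profinite-group plumbing over
abc-iut-L4-t1's interface `FundamentalExtension` (no geometry is claimed): the two classes of
homomorphisms of extensions with respect to which S. Mochizuki, *Topics in absolute anabelian
geometry III*, Thm 1.9 (final paragraph, kurims p. 38) asserts functoriality — "arbitrary open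
injective homomorphisms of extensions of profinite groups" and "homomorphisms of extensions of
profinite groups arising from a base-change of the base field" — each realised by a CONSTRUCTION:

* A1 `FundamentalExtension.ofOpenSubgroup E U` — the extension `1 → Δ ∩ U → U → aug(U) → 1` cut out by
  an open subgroup `U ⊆ Π` (e.g. `Π_V ⊆ Π_X` for a finite étale `V → X`), with the inclusion
  `ofOpenSubgroupι : E.ofOpenSubgroup U ⟶ E`, PROVED open injective (`isOpenInjective_ofOpenSubgroupι`),
  and `geom_ofOpenSubgroup` / `map_geom_ofOpenSubgroup` (`Δ_U = Δ ∩ U`, both directions);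
* A8 `FundamentalExtension.pullback E φ` — the base change `Π ×_G G' → G'` along a continuous
  homomorphism `φ : G' → G` (e.g. `G_{k'} → G_k`, or a decomposition group `G_{k_v} ↪ G_k`), with the
  first projection `pullbackι : E.pullback φ ⟶ E`, PROVED to arise from a base change
  (`isBaseChange_pullbackι`), its universal property (`pullbackLift`, `pullbackLift_comp_ι`,
  `pullbackLift_unique`), functoriality (`pullbackMap`), and the closed-subgroup specialisation
  `restrictGal E H := E.pullback (H ↪ G)` with `restrictGalArithEquiv : (E.restrictGal H).arith ≃ₜ* aug⁻¹(H)`.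

No `instance`, no notation; nothing here bears on the disputed [IUTchIII] Cor. 3.12; typed ≠ proved.
-/

open CategoryTheory Topology

universe u

namespace Literature.AnabelianGeometry.AbsoluteAnabelian

namespace FundamentalExtension

variable (E : FundamentalExtension.{u})

/-! ### A1: restriction to an open subgroup of `Π` -/

section OpenSubgroup

variable (U : OpenSubgroup E.arith)

/-- An open subgroup of the (compact) group `Π` has finite index.
[cite: MochizukiAbsTopIII2015, Thm 1.9 p.38] -/
theorem finiteIndex_openSubgroup : (U : Subgroup E.arith).FiniteIndex :=
  Subgroup.finiteIndex_of_finite_quotient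

/-- `U ⊆ Π` as a closed subgroup (open subgroups of topological groups are closed).
[cite: MochizukiAbsTopIII2015, Thm 1.9 p.38] -/
def openAsClosed : ClosedSubgroup E.arith where
  toSubgroup := (U : Subgroup E.arith)
  isClosed' := U.isClosed

/-- The image `aug(U) ⊆ G` of an open subgroup `U ⊆ Π`, a closed subgroup of `G` (compact image).
[cite: MochizukiAbsTopIII2015, Thm 1.9 p.38] -/
def augImage : ClosedSubgroup E.gal where
  toSubgroup := (U : Subgroup E.arith).map E.aug.toMonoidHom
  isClosed' := by
    change IsClosed (((U : Subgroup E.arith).map E.aug.toMonoidHom : Subgroup E.gal) : Set E.gal)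
    rw [Subgroup.coe_map]
    exact (U.isClosed.isCompact.image (map_continuous E.aug)).isClosed

/-- Membership in `aug(U)`. [cite: MochizukiAbsTopIII2015, Thm 1.9 p.38] -/
theorem mem_augImage_iff {g : E.gal} :
    g ∈ (E.augImage U).toSubgroup ↔ ∃ x ∈ (U : Subgroup E.arith), E.aug x = g :=
  Subgroup.mem_map

/-- `aug(U)` has finite index in `G` (`aug` is onto). [cite: MochizukiAbsTopIII2015, Thm 1.9 p.38] -/
theorem finiteIndex_augImage : (E.augImage U).toSubgroup.FiniteIndex := by
  haveI := E.finiteIndex_openSubgroup U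
  refine ⟨fun h0 => ?_⟩
  have hd := Subgroup.index_map_dvd (U : Subgroup E.arith) (f := E.aug.toMonoidHom) E.aug_surjective
  change ((U : Subgroup E.arith).map E.aug.toMonoidHom).index = 0 at h0
  rw [h0, zero_dvd_iff] at hd
  exact Subgroup.FiniteIndex.index_ne_zero hd

/-- `aug(U)` is open in `G` (closed of finite index). [cite: MochizukiAbsTopIII2015, Thm 1.9 p.38] -/
theorem isOpen_augImage : IsOpen ((E.augImage U).toSubgroup : Set E.gal) := by
  haveI := E.finiteIndex_augImage U
  exact Subgroup.isOpen_of_isClosed_of_finiteIndex _ (E.augImage U).isClosed'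

/-- Every element of `U` has augmentation in `aug(U)`. [cite: MochizukiAbsTopIII2015, Thm 1.9 p.38] -/
theorem aug_mem_augImage (x : (U : Subgroup E.arith)) :
    (E.aug.toMonoidHom.restrict (U : Subgroup E.arith)) x ∈ (E.augImage U).toSubgroup :=
  ⟨x.1, x.2, rfl⟩

/-- **A1.** The extension `1 → Δ ∩ U → U → aug(U) → 1` cut out by an open subgroup `U ⊆ Π` (open, hence
closed, hence profinite; `aug(U) ⊆ G` is open of finite index). [cite: MochizukiAbsTopIII2015, Thm 1.9 p.38] -/
noncomputable def ofOpenSubgroup : FundamentalExtension.{u} where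
  arith := ProfiniteGrp.ofClosedSubgroup (E.openAsClosed U)
  gal := ProfiniteGrp.ofClosedSubgroup (E.augImage U)
  aug :=
    { (E.aug.toMonoidHom.restrict (U : Subgroup E.arith)).codRestrict (E.augImage U).toSubgroup
        (E.aug_mem_augImage U) with
      continuous_toFun := ((map_continuous E.aug).comp continuous_subtype_val).subtype_mk _ }
  aug_surjective := by
    rintro ⟨g, x, hx, rfl⟩
    exact ⟨⟨x, hx⟩, rfl⟩

/-- The `Π` of `E.ofOpenSubgroup U` is `U`. [cite: MochizukiAbsTopIII2015, Thm 1.9 p.38] -/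
theorem ofOpenSubgroup_arith :
    (E.ofOpenSubgroup U).arith = ProfiniteGrp.ofClosedSubgroup (E.openAsClosed U) := rfl

/-- The `G` of `E.ofOpenSubgroup U` is `aug(U)`. [cite: MochizukiAbsTopIII2015, Thm 1.9 p.38] -/
theorem ofOpenSubgroup_gal :
    (E.ofOpenSubgroup U).gal = ProfiniteGrp.ofClosedSubgroup (E.augImage U) := rfl

/-- The augmentation of `E.ofOpenSubgroup U` is the restriction of `aug`.
[cite: MochizukiAbsTopIII2015, Thm 1.9 p.38] -/
@[simp] theorem ofOpenSubgroup_aug_apply_coe (x : (E.ofOpenSubgroup U).arith) :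
    ((E.ofOpenSubgroup U).aug x).1 = E.aug x.1 := rfl

/-- **A1, the inclusion** `E.ofOpenSubgroup U ⟶ E` (`U ↪ Π`, `aug(U) ↪ G`).
[cite: MochizukiAbsTopIII2015, Thm 1.9 p.38] -/
noncomputable def ofOpenSubgroupι : E.ofOpenSubgroup U ⟶ E where
  arith := { (U : Subgroup E.arith).subtype with continuous_toFun := continuous_subtype_val }
  gal := { (E.augImage U).toSubgroup.subtype with continuous_toFun := continuous_subtype_val }
  comm := fun _ => rfl

/-- The `Π`-component of the inclusion is the subtype inclusion. [cite: MochizukiAbsTopIII2015, Thm 1.9 p.38] -/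
@[simp] theorem ofOpenSubgroupι_arith_apply (x : (E.ofOpenSubgroup U).arith) :
    (E.ofOpenSubgroupι U).arith x = x.1 := rfl

/-- The `G`-component of the inclusion is the subtype inclusion. [cite: MochizukiAbsTopIII2015, Thm 1.9 p.38] -/
@[simp] theorem ofOpenSubgroupι_gal_apply (g : (E.ofOpenSubgroup U).gal) :
    (E.ofOpenSubgroupι U).gal g = g.1 := rfl

/-- **A1: the inclusion `E.ofOpenSubgroup U ⟶ E` is an open injective homomorphism of extensions**
("arbitrary open injective homomorphisms of extensions of profinite groups", Thm 1.9 p.38).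
[cite: MochizukiAbsTopIII2015, Thm 1.9 p.38] -/
theorem isOpenInjective_ofOpenSubgroupι : Hom.IsOpenInjective (E.ofOpenSubgroupι U) where
  arith_injective := fun _ _ h => Subtype.ext h
  isOpen_range_arith := by
    have h : Set.range (E.ofOpenSubgroupι U).arith = ((U : Subgroup E.arith) : Set E.arith) := by
      ext x
      constructor
      · rintro ⟨y, rfl⟩
        exact y.2
      · intro hx
        exact ⟨⟨x, hx⟩, rfl⟩
    rw [h]
    exact U.isOpen
  gal_injective := fun _ _ h => Subtype.ext h
  isOpen_range_gal := by
    have h : Set.range (E.ofOpenSubgroupι U).gal = ((E.augImage U).toSubgroup : Set E.gal) := by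
      ext g
      constructor
      · rintro ⟨y, rfl⟩
        exact y.2
      · intro hg
        exact ⟨⟨g, hg⟩, rfl⟩
    rw [h]
    exact E.isOpen_augImage U

/-- Membership in `Δ` of the restricted extension: `x ∈ Δ_U ↔ x ∈ Δ`. [cite: MochizukiAbsTopIII2015, Thm 1.9 p.38] -/
theorem mem_geom_ofOpenSubgroup_iff (x : (E.ofOpenSubgroup U).arith) :
    x ∈ (E.ofOpenSubgroup U).geom ↔ x.1 ∈ E.geom := by
  rw [mem_geom, mem_geom]
  exact ⟨fun h => congrArg Subtype.val h, fun h => Subtype.ext h⟩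

/-- **`Δ_U = Δ ∩ U`** (as a subgroup of `U`). [cite: MochizukiAbsTopIII2015, Thm 1.9 p.38] -/
theorem geom_ofOpenSubgroup :
    (E.ofOpenSubgroup U).geom = E.geom.subgroupOf (U : Subgroup E.arith) := by
  ext x
  exact (E.mem_geom_ofOpenSubgroup_iff U x).trans Subgroup.mem_subgroupOf.symm

/-- **`Δ_U = Δ ∩ U`** (as a subgroup of `Π`, through the inclusion). [cite: MochizukiAbsTopIII2015, Thm 1.9 p.38] -/
theorem map_geom_ofOpenSubgroup :
    (E.ofOpenSubgroup U).geom.map (E.ofOpenSubgroupι U).arith.toMonoidHom =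
      E.geom ⊓ (U : Subgroup E.arith) := by
  ext x
  constructor
  · rintro ⟨y, hy, rfl⟩
    exact ⟨(E.mem_geom_ofOpenSubgroup_iff U y).1 hy, y.2⟩
  · rintro ⟨hx, hxU⟩
    exact ⟨⟨x, hxU⟩, (E.mem_geom_ofOpenSubgroup_iff U ⟨x, hxU⟩).2 hx, rfl⟩

end OpenSubgroup

/-! ### A8: base change along `φ : G' → G` -/

section Pullback

variable {G' : ProfiniteGrp.{u}} (φ : G' →ₜ* E.gal)

/-- The fibre product `Π ×_G G' = {(x, g') | aug x = φ g'}`, a closed subgroup of `Π × G'`.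
[cite: MochizukiAbsTopIII2015, Thm 1.9 p.38] -/
def pullbackSubgroup : ClosedSubgroup (ProfiniteGrp.of (E.arith × G')) where
  toSubgroup := MonoidHom.eqLocus (E.aug.toMonoidHom.comp (MonoidHom.fst E.arith G'))
    (φ.toMonoidHom.comp (MonoidHom.snd E.arith G'))
  isClosed' := isClosed_eq ((map_continuous E.aug).comp continuous_fst)
    ((map_continuous φ).comp continuous_snd)

/-- Membership in the fibre product. [cite: MochizukiAbsTopIII2015, Thm 1.9 p.38] -/
theorem mem_pullbackSubgroup_iff (p : E.arith × G') :
    p ∈ (E.pullbackSubgroup φ).toSubgroup ↔ E.aug p.1 = φ p.2 := Iff.rfl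

/-- **A8.** The base change `1 → Δ → Π ×_G G' → G' → 1` of `E` along `φ : G' → G` (surjective onto
`G'` because `aug` is onto). [cite: MochizukiAbsTopIII2015, Thm 1.9 p.38] -/
noncomputable def pullback : FundamentalExtension.{u} where
  arith := ProfiniteGrp.ofClosedSubgroup (E.pullbackSubgroup φ)
  gal := G'
  aug :=
    { (MonoidHom.snd E.arith G').comp (E.pullbackSubgroup φ).toSubgroup.subtype with
      continuous_toFun := continuous_snd.comp continuous_subtype_val }
  aug_surjective := fun g => by
    obtain ⟨x, hx⟩ := E.aug_surjective (φ g)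
    exact ⟨⟨(x, g), hx⟩, rfl⟩

/-- The `G` of the base change is `G'`. [cite: MochizukiAbsTopIII2015, Thm 1.9 p.38] -/
theorem pullback_gal : (E.pullback φ).gal = G' := rfl

/-- The `Π` of the base change is the fibre product. [cite: MochizukiAbsTopIII2015, Thm 1.9 p.38] -/
theorem pullback_arith : (E.pullback φ).arith = ProfiniteGrp.ofClosedSubgroup (E.pullbackSubgroup φ) := rfl

/-- The augmentation of the base change is the second projection. [cite: MochizukiAbsTopIII2015, Thm 1.9 p.38] -/
@[simp] theorem pullback_aug_apply (p : (E.pullback φ).arith) : (E.pullback φ).aug p = p.1.2 := rfl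

/-- A point of the fibre product satisfies `aug x = φ g'`. [cite: MochizukiAbsTopIII2015, Thm 1.9 p.38] -/
theorem aug_fst_eq (p : (E.pullback φ).arith) : E.aug p.1.1 = φ p.1.2 := p.2

/-- **A8, the projection** `E.pullback φ ⟶ E` (`(x, g') ↦ x` on `Π`, `φ` on `G`).
[cite: MochizukiAbsTopIII2015, Thm 1.9 p.38] -/
noncomputable def pullbackι : E.pullback φ ⟶ E where
  arith :=
    { (MonoidHom.fst E.arith G').comp (E.pullbackSubgroup φ).toSubgroup.subtype with
      continuous_toFun := continuous_fst.comp continuous_subtype_val }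
  gal := φ
  comm := fun p => E.aug_fst_eq φ p

/-- The `Π`-component of the projection. [cite: MochizukiAbsTopIII2015, Thm 1.9 p.38] -/
@[simp] theorem pullbackι_arith_apply (p : (E.pullback φ).arith) : (E.pullbackι φ).arith p = p.1.1 := rfl

/-- The `G`-component of the projection is `φ`. [cite: MochizukiAbsTopIII2015, Thm 1.9 p.38] -/
@[simp] theorem pullbackι_gal : (E.pullbackι φ).gal = φ := rfl

/-- Membership in `Δ` of the base change: `(x, g') ∈ Δ ↔ g' = 1`. [cite: MochizukiAbsTopIII2015, Thm 1.9 p.38] -/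
theorem mem_geom_pullback_iff (p : (E.pullback φ).arith) : p ∈ (E.pullback φ).geom ↔ p.1.2 = 1 :=
  Iff.rfl

/-- **A8: the projection `E.pullback φ ⟶ E` arises from a base change** — it maps `Δ` bijectively
onto `Δ` ("homomorphisms of extensions of profinite groups arising from a base-change of the base
field", Thm 1.9 p.38). [cite: MochizukiAbsTopIII2015, Thm 1.9 p.38] -/
theorem isBaseChange_pullbackι : Hom.IsBaseChange (E.pullbackι φ) where
  bijOn_geom := by
    refine ⟨fun p hp => ?_, fun p hp q hq hpq => ?_, fun x hx => ?_⟩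
    · have hp' : p.1.2 = 1 := hp
      have h2 := E.aug_fst_eq φ p
      change E.aug p.1.1 = 1
      rw [h2, hp', map_one]
    · have hp' : p.1.2 = 1 := hp
      have hq' : q.1.2 = 1 := hq
      exact Subtype.ext (Prod.ext hpq (hp'.trans hq'.symm))
    · have hx' : E.aug x = 1 := hx
      exact ⟨⟨(x, 1), by rw [mem_pullbackSubgroup_iff, hx', map_one]⟩, rfl, rfl⟩

variable {F : FundamentalExtension.{u}}

/-- The graph of a lift lands in the fibre product. [cite: MochizukiAbsTopIII2015, Thm 1.9 p.38] -/
theorem lift_mem_pullbackSubgroup (f : F ⟶ E) (ψ : F.gal →ₜ* G') (hψ : ∀ g, φ (ψ g) = f.gal g)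
    (x : F.arith) :
    (f.arith.toMonoidHom.prod (ψ.toMonoidHom.comp F.aug.toMonoidHom)) x ∈
      (E.pullbackSubgroup φ).toSubgroup := by
  rw [mem_pullbackSubgroup_iff]
  change E.aug (f.arith x) = φ (ψ (F.aug x))
  rw [f.comm, hψ]

/-- **Universal property of the base change, existence**: a homomorphism `f : F ⟶ E` whose
`G`-component factors as `φ ∘ ψ` lifts to `F ⟶ E.pullback φ`. [cite: MochizukiAbsTopIII2015, Thm 1.9 p.38] -/
noncomputable def pullbackLift (f : F ⟶ E) (ψ : F.gal →ₜ* G') (hψ : ∀ g, φ (ψ g) = f.gal g) :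
    F ⟶ E.pullback φ where
  arith :=
    { (f.arith.toMonoidHom.prod (ψ.toMonoidHom.comp F.aug.toMonoidHom)).codRestrict
        (E.pullbackSubgroup φ).toSubgroup (E.lift_mem_pullbackSubgroup φ f ψ hψ) with
      continuous_toFun := ((map_continuous f.arith).prodMk
        ((map_continuous ψ).comp (map_continuous F.aug))).subtype_mk _ }
  gal := ψ
  comm := fun _ => rfl

/-- The `Π`-component of the lift. [cite: MochizukiAbsTopIII2015, Thm 1.9 p.38] -/
@[simp] theorem pullbackLift_arith_apply_coe (f : F ⟶ E) (ψ : F.gal →ₜ* G')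
    (hψ : ∀ g, φ (ψ g) = f.gal g) (x : F.arith) :
    ((E.pullbackLift φ f ψ hψ).arith x).1 = (f.arith x, ψ (F.aug x)) := rfl

/-- The lift followed by the projection is `f`. [cite: MochizukiAbsTopIII2015, Thm 1.9 p.38] -/
theorem pullbackLift_comp_ι (f : F ⟶ E) (ψ : F.gal →ₜ* G') (hψ : ∀ g, φ (ψ g) = f.gal g) :
    E.pullbackLift φ f ψ hψ ≫ E.pullbackι φ = f :=
  Hom.ext (ContinuousMonoidHom.ext fun _ => rfl) (ContinuousMonoidHom.ext fun g => hψ g)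

/-- The `G`-component of the lift is `ψ`. [cite: MochizukiAbsTopIII2015, Thm 1.9 p.38] -/
@[simp] theorem pullbackLift_gal (f : F ⟶ E) (ψ : F.gal →ₜ* G') (hψ : ∀ g, φ (ψ g) = f.gal g) :
    (E.pullbackLift φ f ψ hψ).gal = ψ := rfl

/-- **Universal property of the base change, uniqueness.** [cite: MochizukiAbsTopIII2015, Thm 1.9 p.38] -/
theorem pullbackLift_unique (f : F ⟶ E) (ψ : F.gal →ₜ* G') (hψ : ∀ g, φ (ψ g) = f.gal g)
    (g : F ⟶ E.pullback φ) (h₁ : g ≫ E.pullbackι φ = f) (h₂ : g.gal = ψ) :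
    g = E.pullbackLift φ f ψ hψ := by
  refine Hom.ext (ContinuousMonoidHom.ext fun x => Subtype.ext (Prod.ext ?_ ?_)) (by rw [h₂]; rfl)
  · exact congrArg (fun k : F ⟶ E => k.arith x) h₁
  · have hc := g.comm x
    rw [h₂] at hc
    exact hc

/-- **Functoriality of the base change** in `φ`: a homomorphism `θ : G₁ → G₂` over `G`
(`φ₂ ∘ θ = φ₁`) induces `E.pullback φ₁ ⟶ E.pullback φ₂`. [cite: MochizukiAbsTopIII2015, Thm 1.9 p.38] -/
noncomputable def pullbackMap {G₁ G₂ : ProfiniteGrp.{u}} (φ₁ : G₁ →ₜ* E.gal) (φ₂ : G₂ →ₜ* E.gal)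
    (θ : G₁ →ₜ* G₂) (hθ : ∀ g, φ₂ (θ g) = φ₁ g) : E.pullback φ₁ ⟶ E.pullback φ₂ :=
  E.pullbackLift φ₂ (E.pullbackι φ₁) θ (fun g => by rw [pullbackι_gal]; exact hθ g)

/-- `pullbackMap` commutes with the projections. [cite: MochizukiAbsTopIII2015, Thm 1.9 p.38] -/
theorem pullbackMap_comp_ι {G₁ G₂ : ProfiniteGrp.{u}} (φ₁ : G₁ →ₜ* E.gal) (φ₂ : G₂ →ₜ* E.gal)
    (θ : G₁ →ₜ* G₂) (hθ : ∀ g, φ₂ (θ g) = φ₁ g) :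
    E.pullbackMap φ₁ φ₂ θ hθ ≫ E.pullbackι φ₂ = E.pullbackι φ₁ := by
  unfold pullbackMap
  exact E.pullbackLift_comp_ι φ₂ (E.pullbackι φ₁) θ _

/-- The `Π`-component of `pullbackMap`: `(x, g) ↦ (x, θ g)`. [cite: MochizukiAbsTopIII2015, Thm 1.9 p.38] -/
@[simp] theorem pullbackMap_arith_apply_coe {G₁ G₂ : ProfiniteGrp.{u}} (φ₁ : G₁ →ₜ* E.gal)
    (φ₂ : G₂ →ₜ* E.gal) (θ : G₁ →ₜ* G₂) (hθ : ∀ g, φ₂ (θ g) = φ₁ g) (p : (E.pullback φ₁).arith) :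
    ((E.pullbackMap φ₁ φ₂ θ hθ).arith p).1 = (p.1.1, θ p.1.2) := rfl

/-- `pullbackMap` arises from a base change (bijective on `Δ`). [cite: MochizukiAbsTopIII2015, Thm 1.9 p.38] -/
theorem isBaseChange_pullbackMap {G₁ G₂ : ProfiniteGrp.{u}} (φ₁ : G₁ →ₜ* E.gal) (φ₂ : G₂ →ₜ* E.gal)
    (θ : G₁ →ₜ* G₂) (hθ : ∀ g, φ₂ (θ g) = φ₁ g) : Hom.IsBaseChange (E.pullbackMap φ₁ φ₂ θ hθ) where
  bijOn_geom := by
    refine ⟨fun p hp => ?_, fun p hp q hq hpq => ?_, fun q hq => ?_⟩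
    · have hp' : p.1.2 = 1 := hp
      show ((E.pullbackMap φ₁ φ₂ θ hθ).arith p).1.2 = 1
      rw [pullbackMap_arith_apply_coe, hp', map_one]
    · have hp' : p.1.2 = 1 := hp
      have hq' : q.1.2 = 1 := hq
      have h1 : ((E.pullbackMap φ₁ φ₂ θ hθ).arith p).1.1 = ((E.pullbackMap φ₁ φ₂ θ hθ).arith q).1.1 :=
        by rw [hpq]
      rw [pullbackMap_arith_apply_coe, pullbackMap_arith_apply_coe] at h1
      exact Subtype.ext (Prod.ext h1 (hp'.trans hq'.symm))
    · have hq' : q.1.2 = 1 := hq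
      have hq2 := E.aug_fst_eq φ₂ q
      have hmem : ((q.1.1, 1) : E.arith × G₁) ∈ (E.pullbackSubgroup φ₁).toSubgroup := by
        show E.aug q.1.1 = φ₁ 1
        rw [map_one, hq2, hq', map_one]
      refine ⟨⟨(q.1.1, 1), hmem⟩, rfl, Subtype.ext ?_⟩
      show ((q.1.1, θ 1) : E.arith × G₂) = q.1
      rw [map_one, ← hq']

end Pullback

/-! ### A8, closed-subgroup specialisation: restriction to `H ⊆ G` -/

section RestrictGal

variable (H : ClosedSubgroup E.gal)

/-- **Restriction of the base**: `E.restrictGal H := E.pullback (H ↪ G)` — e.g. the decomposition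
group `G_{k_v} ↪ G_k` ([AbsTopIII] Rmk 1.9.5 (ii) p.39). [cite: MochizukiAbsTopIII2015, Thm 1.9 p.38] -/
noncomputable def restrictGal : FundamentalExtension.{u} :=
  E.pullback (G' := ProfiniteGrp.ofClosedSubgroup H)
    { H.toSubgroup.subtype with continuous_toFun := continuous_subtype_val }

/-- The `G` of `E.restrictGal H` is `H`. [cite: MochizukiAbsTopIII2015, Thm 1.9 p.38] -/
theorem restrictGal_gal : (E.restrictGal H).gal = ProfiniteGrp.ofClosedSubgroup H := rfl

/-- The preimage `aug⁻¹(H) ⊆ Π`, a closed subgroup. [cite: MochizukiAbsTopIII2015, Thm 1.9 p.38] -/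
def augPreimage : ClosedSubgroup E.arith where
  toSubgroup := H.toSubgroup.comap E.aug.toMonoidHom
  isClosed' := H.isClosed'.preimage (map_continuous E.aug)

/-- Membership in `aug⁻¹(H)`. [cite: MochizukiAbsTopIII2015, Thm 1.9 p.38] -/
theorem mem_augPreimage_iff {x : E.arith} : x ∈ (E.augPreimage H).toSubgroup ↔ E.aug x ∈ H.toSubgroup :=
  Iff.rfl

/-- The first coordinate of a point of `Π ×_G H` lies in `aug⁻¹(H)`. [cite: MochizukiAbsTopIII2015, Thm 1.9 p.38] -/
theorem fst_mem_augPreimage (p : (E.restrictGal H).arith) : p.1.1 ∈ (E.augPreimage H).toSubgroup := by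
  rw [mem_augPreimage_iff, show E.aug p.1.1 = p.1.2.1 from p.2]
  exact p.1.2.2

/-- **`(E.restrictGal H).arith ≃ₜ* aug⁻¹(H)`**: the fibre product `Π ×_G H` IS the preimage of `H`.
[cite: MochizukiAbsTopIII2015, Thm 1.9 p.38] -/
noncomputable def restrictGalArithEquiv :
    (E.restrictGal H).arith ≃ₜ* ProfiniteGrp.ofClosedSubgroup (E.augPreimage H) where
  toFun p := ⟨p.1.1, E.fst_mem_augPreimage H p⟩
  invFun x := ⟨(x.1, ⟨E.aug x.1, x.2⟩), rfl⟩
  left_inv p := Subtype.ext (Prod.ext rfl (Subtype.ext p.2))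
  right_inv _ := rfl
  map_mul' _ _ := rfl
  continuous_toFun := (continuous_fst.comp continuous_subtype_val).subtype_mk _
  continuous_invFun := (continuous_subtype_val.prodMk
    (((map_continuous E.aug).comp continuous_subtype_val).subtype_mk _)).subtype_mk _

/-- The `Π`-component of `E.restrictGal H ⟶ E` is the inclusion `aug⁻¹(H) ↪ Π` through the
identification `restrictGalArithEquiv`. [cite: MochizukiAbsTopIII2015, Thm 1.9 p.38] -/
theorem pullbackι_arith_restrictGal (p : (E.restrictGal H).arith) :
    (E.pullbackι _ : E.restrictGal H ⟶ E).arith p = (E.restrictGalArithEquiv H p).1 := rfl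

end RestrictGal

end FundamentalExtension

end Literature.AnabelianGeometry.AbsoluteAnabelian
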